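import Literature.NumberTheory.EllipticCurves.DeShalit1987.KatzPAdicLFunction
import HarnessLib

/-!
# The Katz–de Shalit `p`-adic `L`-VALUE `L_{p,𝔣}(λ)` at a split prime of any parity: the value of a
# twisted branch at the trivial character (de Shalit 1987, II.4.16 (49)–(50)) — proofs only

Companion of `DeShalit1987/KatzPAdicLFunction.lean` (cell `bsd-goldfeld`, seat `bsd-goldfeld-ty`
gen 4). That file types de Shalit's theorem II.4.14 in the power-series language of II.4.16–4.17 as
the predicate `IsKatzBranch ι v v̄ S κ γ λ Ω δ Ω_p G` ("`G(r(γ) - 1) = L_{p,𝔣}(λρ)` for the avatars `r`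
of `ρ` through `Γ_κ`, with the interpolation formula (50) whenever `ε = λρ` has type `(-m, j)`,
`0 ≤ j < m`, and is unramified outside `S ∪ {𝔭̄}`") and the named fact
`thmII414_exists_katzBranch`. Here we prove, with NO new fact:

* the avatar bookkeeping of the TRIVIAL character: `1 : Γ_K → GL₁(ℚ̄_p)` is unramified everywhere,
  is the `p`-adic avatar of `1 : HeckeCharacter K` (`isPAdicAvatarOf_one`), factors through every
  `ℤ_p`-extension (`factorsThroughZp_one`) and has value `1` at every `γ` (`avatarValueAt_one_left`)
  — generic API for the BDP / Katz / Hsieh frames, which all quantify over `(ρ, r)` pairs;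
* `IntSeries.hasValueAt_zero`: the value of `Q ∈ 𝒪_{ℂ_p}⟦T⟧` at `T = 0` is its constant term (the
  `𝒪_{ℂ_p}` twin of the tree's `UnrSeries.hasValueAt_zero`), and its uniqueness form;
* **`IsKatzBranch.constantCoeff_eq`**: if the twist `λ` ITSELF lies in the range (type `(-m, j)`,
  `0 ≤ j < m`, unramified outside `S ∪ {𝔭̄}`), then the constant term of the branch is the `p`-adic
  `L`-value, with de Shalit's formula (50) at `ε = λ` (`G(ε⁻¹) = 1`):

  `G(0) = L_{p,𝔣}(λ) = i_p( Ω^{-(m+j)} (2π/δ)^j (1 - λ(𝔭)⁻¹p⁻¹) Γ(m)(2π)^{-m} ∏_{w∈S∪{𝔭̄}}(1 - λ(w)) L(λ,0) ) · Ω_p^{m+j}`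

  — the form in which the Katz `p`-adic `L`-function enters at the TRIVIAL character (Burungale–
  Castella–Skinner–Tian 2022, §8 / Rem. 4.6: "the trivial character is in the range of interpolation
  for `L_v(ψχ)`"; Rubin 1991 §§11–12), now available at `p = 2` through the parity-free fact;
* `thmII414_exists_katzBranch.exists_constantCoeff_eq`: the same packaged from the named fact.

References: [deShalit1987] II.4.16 (49)–(50) (p. 76–77), II.4.14 (36) (p. 71), II.4.11 Rem. (i)
(p. 65); [Castella2018] §2.2 (values at `γ ↦ 1 + T`, value at `𝟙` = constant term).
-/

noncomputable section

open scoped Classical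
open NumberField IsDedekindDomain Field Polynomial
open Literature.NumberTheory.GaloisRepresentations

universe u

namespace Literature.NumberTheory.EllipticCurves

/-! ### §1. The trivial character and its avatar (frame API) -/

section Trivial

variable {K : Type u} [Field K] [NumberField K] {p : ℕ} [Fact p.Prime]

omit [NumberField K] in
/-- The trivial rank-one framed Galois representation is unramified at every finite place (every
inertia group maps to `1`; Serre's definition of "unramified at `v`"); a dot-notation extension of the
tree's `FramedGaloisRep` declared in its home namespace. [cite: SerreAbelianLadic1968, Ch. I §2.1] -/
theorem _root_.Literature.NumberTheory.GaloisRepresentations.FramedGaloisRep.isUnramifiedAt_one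
    {A : Type*} [CommRing A] [TopologicalSpace A] (v : HeightOneSpectrum (𝓞 K)) :
    (1 : FramedGaloisRep K A 1).IsUnramifiedAt v := by
  intro 𝔓 _ σ _
  rfl

/-- **The trivial framed representation `1 : Γ_K → GL₁(ℚ̄_p)` is the `p`-adic avatar of the trivial
Hecke character** (in the tree's sense `IsPAdicAvatarOf`: unramified where `1` is, and every
arithmetic Frobenius has characteristic polynomial `X - ι⁻¹(1)⁻¹ = X - 1`).
[cite: CastellaHsieh2018, §3.3 (p. 9)] -/
theorem isPAdicAvatarOf_one (ι : PadicAlgCl p ≃+* ℂ) :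
    IsPAdicAvatarOf ι (1 : HeckeCharacter K) (1 : FramedGaloisRep K (PadicAlgCl p) 1) := by
  intro v _ _
  refine ⟨FramedGaloisRep.isUnramifiedAt_one v, fun 𝔓 _ σ _ ↦ ?_⟩
  have h1 : (1 : HeckeCharacter K).valueAtUniformizer v = 1 := rfl
  have hσ : (1 : FramedGaloisRep K (PadicAlgCl p) 1) σ = 1 := rfl
  rw [h1, map_one, inv_one, C_1, FramedRep.charpoly, hσ, Units.val_one, Matrix.charpoly_one,
    Fintype.card_fin, pow_one]

omit [NumberField K] in
/-- The trivial framed representation factors through every `ℤ_p`-extension. [cite: Castella2018, Thm. 3.1] -/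
theorem factorsThroughZp_one (κ : ZpExtension K p) :
    FactorsThroughZp κ (1 : FramedGaloisRep K (PadicAlgCl p) 1) := by
  intro σ _
  rfl

omit [NumberField K] in
/-- The trivial framed representation has value `1` at every `γ` (so its evaluation point on any
branch is `T = 1 - 1 = 0`, the trivial character). [cite: Castella2018, §2.2] -/
@[simp] theorem avatarValueAt_one_left (γ : absoluteGaloisGroup K) :
    avatarValueAt (1 : FramedGaloisRep K (PadicAlgCl p) 1) γ = 1 := by
  simp [avatarValueAt]

end Trivial

/-! ### §2. Values of `𝒪_{ℂ_p}⟦T⟧`-elements at `T = 0` -/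

section IntSeriesZero

variable {p : ℕ} [Fact p.Prime]

/-- **The value at the trivial character is the constant term**: `Q(T = 0) = [T⁰]Q` for
`Q ∈ 𝒪_{ℂ_p}⟦T⟧` (`1 + T ↔ γ`); the `𝒪_{ℂ_p}` twin of `UnrSeries.hasValueAt_zero`.
[cite: Castella2018, §2.2 and Thm. 3.2] -/
theorem IntSeries.hasValueAt_zero (Q : PowerSeries (PadicComplexInt p)) :
    IntSeries.HasValueAt Q 0 ((PowerSeries.constantCoeff Q : PadicComplexInt p) : ℂ_[p]) := by
  have h := hasSum_single (f := fun k : ℕ ↦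
    ((PowerSeries.coeff k Q : PadicComplexInt p) : ℂ_[p]) * (0 : ℂ_[p]) ^ k) 0
    (fun k hk ↦ by rw [zero_pow hk, mul_zero])
  simpa [IntSeries.HasValueAt] using h

/-- Any `x` with `Q.HasValueAt 0 x` is the constant term of `Q`. [cite: Castella2018, §2.2] -/
theorem IntSeries.eq_constantCoeff_of_hasValueAt_zero {Q : PowerSeries (PadicComplexInt p)}
    {x : ℂ_[p]} (h : IntSeries.HasValueAt Q 0 x) :
    x = ((PowerSeries.constantCoeff Q : PadicComplexInt p) : ℂ_[p]) :=
  h.unique (IntSeries.hasValueAt_zero Q)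

end IntSeriesZero

end Literature.NumberTheory.EllipticCurves

namespace Literature.NumberTheory.EllipticCurves.DeShalit1987

variable {K : Type u} [Field K] [NumberField K] {p : ℕ} [Fact p.Prime]
  {ι : PadicAlgCl p ≃+* ℂ} {v vbar : HeightOneSpectrum (𝓞 K)} {S : Finset (HeightOneSpectrum (𝓞 K))}
  {κ : ZpExtension K p} {γ : absoluteGaloisGroup K} {lam : HeckeCharacter K} {Ω δ : ℂ} {Ωp : ℂ_[p]}
  {G : PowerSeries (PadicComplexInt p)}

/-! ### §3. The branch at a prescribed product `ε = λρ` and at the trivial character -/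

/-- `IsKatzBranch` with the product `λρ` named: for `ε = λρ` in the range, `G(r(γ) - 1)` is (50)
at `ε`. A restatement by substitution (useful when `ε` is given by a defining property).
[cite: deShalit1987, II.4.16 (49)–(50) (p. 76–77)] -/
theorem IsKatzBranch.hasValueAt_of_eq (hG : IsKatzBranch ι v vbar S κ γ lam Ω δ Ωp G)
    {ρ ε : HeckeCharacter K} (hε : lam * ρ = ε) {r : FramedGaloisRep K (PadicAlgCl p) 1} {m j : ℕ}
    (hr : IsPAdicAvatarOf ι ρ r) (hκ : FactorsThroughZp κ r) (hjm : j < m)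
    (hinf : ε.HasInfinityType (fun _ ↦ -(m : ℤ)) (fun _ ↦ (j : ℤ)))
    (hunr : ∀ w : HeightOneSpectrum (𝓞 K), w ∉ S → w ≠ vbar → ε.IsUnramifiedAt w)
    (hL : LFunction.HasEntireContinuation (heckeLFunction ε)) :
    IntSeries.HasValueAt G (avatarValueAt r γ - 1)
      (((ι.symm (interpolationValue p v vbar S ε m j Ω δ (hL.continuation 0)) :
          PadicAlgCl p) : ℂ_[p]) * Ωp ^ (m + j)) := by
  subst hε
  exact hG ρ r m j hr hκ hjm hinf hunr hL

/-- **The branch at the trivial character.** If the twist `λ` itself has type `(-m, j)`,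
`0 ≤ j < m`, and is unramified outside `S ∪ {𝔭̄}`, then (taking `ρ = 1`, `r = 1`) the value of `G`
at `T = 0` is de Shalit's (50) at `ε = λ`: `G(0) = L_{p,𝔣}(λ)`.
[cite: deShalit1987, II.4.16 (49)–(50) (p. 76–77) and II.4.11 Remark (i) (p. 65)] -/
theorem IsKatzBranch.hasValueAt_trivial (hG : IsKatzBranch ι v vbar S κ γ lam Ω δ Ωp G) {m j : ℕ}
    (hjm : j < m) (hinf : lam.HasInfinityType (fun _ ↦ -(m : ℤ)) (fun _ ↦ (j : ℤ)))
    (hunr : ∀ w : HeightOneSpectrum (𝓞 K), w ∉ S → w ≠ vbar → lam.IsUnramifiedAt w)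
    (hL : LFunction.HasEntireContinuation (heckeLFunction lam)) :
    IntSeries.HasValueAt G 0
      (((ι.symm (interpolationValue p v vbar S lam m j Ω δ (hL.continuation 0)) :
          PadicAlgCl p) : ℂ_[p]) * Ωp ^ (m + j)) := by
  have h := hG.hasValueAt_of_eq (mul_one lam) (isPAdicAvatarOf_one ι) (factorsThroughZp_one κ)
    hjm hinf hunr hL
  rwa [avatarValueAt_one_left, sub_self] at h

/-- **The Katz–de Shalit `p`-adic `L`-VALUE `L_{p,𝔣}(λ) = G(0)` with its formula (50)**: for `λ`
in the range, the constant term of the `λ`-twisted branch is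
`i_p(Ω^{-(m+j)} (2π/δ)^j (1 - λ(𝔭)⁻¹ p⁻¹) Γ(m)(2π)^{-m} ∏_{w ∈ S ∪ {𝔭̄}}(1 - λ(w)) · L(λ, 0)) · Ω_p^{m+j}`
— valid at EVERY split prime `p`, `p = 2` included (no parity enters `IsKatzBranch` or the fact).
[cite: deShalit1987, II.4.16 (49)–(50) (p. 76–77), II.4.14 (36) (p. 71)] -/
theorem IsKatzBranch.constantCoeff_eq (hG : IsKatzBranch ι v vbar S κ γ lam Ω δ Ωp G) {m j : ℕ}
    (hjm : j < m) (hinf : lam.HasInfinityType (fun _ ↦ -(m : ℤ)) (fun _ ↦ (j : ℤ)))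
    (hunr : ∀ w : HeightOneSpectrum (𝓞 K), w ∉ S → w ≠ vbar → lam.IsUnramifiedAt w)
    (hL : LFunction.HasEntireContinuation (heckeLFunction lam)) :
    ((PowerSeries.constantCoeff G : PadicComplexInt p) : ℂ_[p]) =
      ((ι.symm (interpolationValue p v vbar S lam m j Ω δ (hL.continuation 0)) :
          PadicAlgCl p) : ℂ_[p]) * Ωp ^ (m + j) :=
  (IntSeries.eq_constantCoeff_of_hasValueAt_zero (hG.hasValueAt_trivial hjm hinf hunr hL)).symm

/-- **Existence form, from the named fact**: at every split prime `p` (any parity) there are periods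
`Ω ≠ 0`, `Ω_p ∈ R₀^×` and `δ` (`δ² = ± d_K`) such that for every modulus `S` away from `p`, every
algebraic `λ` of type `(-m, j)`, `0 ≤ j < m`, unramified outside `S ∪ {𝔭̄}`, and every
`ℤ_p`-extension `κ` with topological generator `γ`, the `λ`-branch `G` exists AND its constant term is
the `p`-adic `L`-value `L_{p,𝔣}(λ)` given by (50). (Unramified outside `S ∪ {𝔭̄}` implies unramified
outside `S ∪ {v, v̄}`, the hypothesis of the fact.)
[cite: deShalit1987, II Thm. 4.14 (p. 71) and II.4.16 (49)–(50) (p. 76–77)] -/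
theorem thmII414_exists_katzBranch.exists_constantCoeff_eq (h : thmII414_exists_katzBranch)
    (p : ℕ) [Fact p.Prime] (K : Type) [Field K] [NumberField K] (hK : IsImaginaryQuadratic K)
    (ι : PadicAlgCl p ≃+* ℂ) (v vbar : HeightOneSpectrum (𝓞 K))
    (hv : ((p : ℕ) : 𝓞 K) ∈ v.asIdeal) (hvbar : ((p : ℕ) : 𝓞 K) ∈ vbar.asIdeal) (hne : vbar ≠ v)
    (hι : ∀ (w : InfinitePlace K) (k : 𝓞 K), k ∈ v.asIdeal ↔ ‖ι.symm (w.embedding (k : K))‖ < 1) :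
    ∃ (Ω δ : ℂ) (Ωp : (unrIntegers p)ˣ), Ω ≠ 0 ∧
      (δ ^ 2 = (NumberField.discr K : ℂ) ∨ δ ^ 2 = -(NumberField.discr K : ℂ)) ∧
      ∀ (S : Finset (HeightOneSpectrum (𝓞 K))), v ∉ S → vbar ∉ S →
      ∀ (lam : HeckeCharacter K) (m j : ℕ), j < m →
        lam.HasInfinityType (fun _ ↦ -(m : ℤ)) (fun _ ↦ (j : ℤ)) →
        (∀ w : HeightOneSpectrum (𝓞 K), w ∉ S → w ≠ vbar → lam.IsUnramifiedAt w) →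
      ∀ (hL : LFunction.HasEntireContinuation (heckeLFunction lam))
        (κ : ZpExtension K p) (γ : absoluteGaloisGroup K), κ.IsTopGenerator γ →
        ∃ G : PowerSeries (PadicComplexInt p),
          IsKatzBranch ι v vbar S κ γ lam Ω δ ((Ωp : unrIntegers p) : ℂ_[p]) G ∧
          ((PowerSeries.constantCoeff G : PadicComplexInt p) : ℂ_[p]) =
            ((ι.symm (interpolationValue p v vbar S lam m j Ω δ (hL.continuation 0)) :
                PadicAlgCl p) : ℂ_[p]) * ((Ωp : unrIntegers p) : ℂ_[p]) ^ (m + j) := by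
  obtain ⟨Ω, δ, Ωp, hΩ, hδ, hall⟩ := h p K hK ι v vbar hv hvbar hne hι
  refine ⟨Ω, δ, Ωp, hΩ, hδ, fun S hvS hvbS lam m j hjm hinf hunr hL κ γ hγ ↦ ?_⟩
  have halg : lam.IsAlgebraic :=
    (HeckeCharacter.isAlgebraic_iff_exists_hasInfinityType lam).mpr ⟨_, _, hinf⟩
  have hunr' : ∀ w : HeightOneSpectrum (𝓞 K), w ∉ S → w ≠ v → w ≠ vbar → lam.IsUnramifiedAt w :=
    fun w hwS _ hwvb ↦ hunr w hwS hwvb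
  obtain ⟨G, hG⟩ := hall S hvS hvbS lam halg hunr' κ γ hγ
  exact ⟨G, hG, hG.constantCoeff_eq hjm hinf hunr hL⟩

end Literature.NumberTheory.EllipticCurves.DeShalit1987

end
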